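import Literature.NumberTheory.Transcendental.PhilipponCriterionStepCut
import HarnessLib

/-!
# Philippon's criterion over Nesterenko's toolkit, XIV: the induction step `(A_r) ⇒ (A_{r−1})` — proofs only

`Literature/NumberTheory/Transcendental/PhilipponCriterionStep.lean` — proofs only (no new
definitions, nothing asserted). Philippon's Lemme 2.14 (Publ. Math. IHÉS 64 (1986), §3,
pp. 43–45: "si `n + 1 ≥ r > 1`, alors `(A_r)` entraîne `(A_{r−1})`") at a fixed level `N`, for the
assertion `Setup.Good` (`PhilipponCriterionSetup.lean`) over Nesterenko's invariants:

* `Setup.Λ_mono`, `Setup.Λ_pred_le`, `Setup.Λ_pred_mul_eq`, `Setup.Λ_pred_mul_le`,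
  `Setup.Λ_pred_mul_size_le` — the
  bookkeeping of the quality factors `Λ_r(N) = λ_r g δ^{r−1}/ξ^{r₀−r}` ("on vérifie que `λ_{r−1}`
  convient", p. 45): `Λ_{r−1} ≤ Λ_r`, `Λ_{r−1} · c ξ δ = Λ_r(cλ_{r−1}/λ_r)`, and
  `Λ_{r−1} · c ξ δ size_N(𝔓) ≤ S(N)` under `(i)_N` when `c λ_{r−1} (B_r + D₀) ≤ 1`;
* `Setup.good_pred_of_rank_lt` — if the prime of `(A_r)` has rank `< r` it already satisfies
  `(A_{r−1})` ("si `𝔓_{N,r}` est de rang `< r`, il n'y a rien à démontrer", p. 43);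
* `Setup.ideg_pred_le`, `Setup.iheight_pred_le`, `Setup.pigeonhole_bound_le`, `Setup.iabs_pred_le` —
  the degree / height / quality bookkeeping of a component of the cut at rank `r − 1`;
* `Setup.good_component` — the cut `J` of `exists_cut` (`PhilipponCriterionStepCut.lean`)
  has, by Prop. 4.7 and the weighted pigeonhole (`exists_component_le_exp`), a component `𝔮 ⊇ 𝔓` of
  rank `r − 1` with `(i)_N`, `(ii)_N` at rank `r − 1` ("il existe donc un idéal premier `𝔓_{N,r−1}` …
  contenant `𝔓_{N,r}` et `ʰQ` … vérifiant …", pp. 44–45);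
* `Setup.step` — the two cases together: `Good λ N r 𝔓 → ∃ 𝔮, Good λ' N (r−1) 𝔮` under the explicit
  largeness hypotheses on `Λ_r(N)`, `C`, `N` and `λ' ≤ λ/c`, `c λ'(B_r + D₀) ≤ 1`,
  `c = 20(1+m²)(2+m(k+3))`.

## References

* [Philippon1986Criteres] P. Philippon, Publ. Math. IHÉS 64 (1986), §3, Lemme 2.14 (pp. 43–45).
* [NesterenkoPhilippon2001] LNM 1752 (2001), Ch. 3 Prop. 4.7, 4.11, Cor. 4.12, Prop. 4.13 (pp. 39–41).
-/

noncomputable section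

open MvPolynomial Real
open Literature.NumberTheory.Transcendental.Nesterenko

attribute [local instance] MvPolynomial.gradedAlgebra

namespace Literature.NumberTheory.Transcendental

namespace PhilipponMain

namespace Setup

variable (𝒮 : Setup)

/-! ### Bookkeeping of the quality factors `Λ_r(N)` -/

/-- `Λ` is non-decreasing in `λ`. [folklore] -/
theorem Λ_mono {lam lam' : ℝ} (h : lam' ≤ lam) (r N : ℕ) : 𝒮.Λ lam' r N ≤ 𝒮.Λ lam r N := by
  unfold Λ
  have := 𝒮.g_pos N
  have := 𝒮.δ_pos N
  have := 𝒮.ξ_pos N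
  apply div_le_div_of_nonneg_right _ (by positivity)
  exact mul_le_mul_of_nonneg_right (mul_le_mul_of_nonneg_right h (𝒮.g_pos N).le) (by positivity)

/-- `Λ_{r−1}(N) ≤ Λ_r(N)` when `0 ≤ λ_{r−1} ≤ λ_r` (as `δ, ξ ≥ 1`). [cite: Philippon1986Criteres, §3 p. 45] -/
theorem Λ_pred_le {lam lam' : ℝ} (h0 : 0 ≤ lam') (hle : lam' ≤ lam) {r : ℕ} (hr2 : 2 ≤ r)
    (hrr : r ≤ 𝒮.r₀) (N : ℕ) : 𝒮.Λ lam' (r - 1) N ≤ 𝒮.Λ lam r N := by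
  obtain ⟨j, rfl⟩ : ∃ j, r = j + 2 := ⟨r - 2, by omega⟩
  unfold Λ
  have h1 : j + 2 - 1 = j + 1 := by omega
  have h2 : 𝒮.r₀ - (j + 1) = (𝒮.r₀ - (j + 2)) + 1 := by omega
  rw [h1, Nat.add_sub_cancel, h2]
  set e := 𝒮.r₀ - (j + 2)
  have hg := 𝒮.g_pos N
  have hδ := 𝒮.δ_pos N
  have hξ := 𝒮.ξ_pos N
  have hδ1 := 𝒮.one_le_δ N
  have hξ1 := 𝒮.one_le_ξ N
  rw [div_le_div_iff₀ (by positivity) (by positivity)]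
  have e1 : lam' * 𝒮.g N * 𝒮.δ N ^ j * 𝒮.ξ N ^ e ≤ lam * 𝒮.g N * 𝒮.δ N ^ j * 𝒮.ξ N ^ e := by
    have h : 0 ≤ 𝒮.g N * 𝒮.δ N ^ j * 𝒮.ξ N ^ e := by positivity
    have := mul_le_mul_of_nonneg_right hle h
    nlinarith
  have e2 : 𝒮.δ N ^ j * 𝒮.ξ N ^ e ≤ 𝒮.δ N ^ (j + 1) * 𝒮.ξ N ^ (e + 1) :=
    mul_le_mul (pow_le_pow_right₀ hδ1 (Nat.le_succ j)) (pow_le_pow_right₀ hξ1 (Nat.le_succ e))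
      (by positivity) (by positivity)
  have hlam : 0 ≤ lam := h0.trans hle
  have e3 := mul_le_mul_of_nonneg_left e2 (mul_nonneg hlam hg.le)
  calc lam' * 𝒮.g N * 𝒮.δ N ^ j * 𝒮.ξ N ^ e ≤ lam * 𝒮.g N * 𝒮.δ N ^ j * 𝒮.ξ N ^ e := e1
    _ = lam * 𝒮.g N * (𝒮.δ N ^ j * 𝒮.ξ N ^ e) := by ring
    _ ≤ lam * 𝒮.g N * (𝒮.δ N ^ (j + 1) * 𝒮.ξ N ^ (e + 1)) := e3
    _ = lam * 𝒮.g N * 𝒮.δ N ^ (j + 1) * 𝒮.ξ N ^ (e + 1) := by ring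

/-- `Λ_{r−1}(N) · (c ξ(N) δ(N)) = Λ_r(N)` computed with `λ_r := c λ_{r−1}`. [cite: Philippon1986Criteres, §3 p. 45] -/
theorem Λ_pred_mul_eq (lam' c : ℝ) {r : ℕ} (hr2 : 2 ≤ r) (hrr : r ≤ 𝒮.r₀) (N : ℕ) :
    𝒮.Λ lam' (r - 1) N * (c * 𝒮.ξ N * 𝒮.δ N) = 𝒮.Λ (c * lam') r N := by
  obtain ⟨j, rfl⟩ : ∃ j, r = j + 2 := ⟨r - 2, by omega⟩
  unfold Λ
  have h1 : j + 2 - 1 = j + 1 := by omega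
  have h2 : 𝒮.r₀ - (j + 1) = (𝒮.r₀ - (j + 2)) + 1 := by omega
  rw [h1, Nat.add_sub_cancel, h2]
  have hξ := (𝒮.ξ_pos N).ne'
  field_simp
  ring

/-- First regime: `Λ_{r−1} · c ξ δ ≤ Λ_r` when `c λ_{r−1} ≤ λ_r`. [cite: Philippon1986Criteres, §3 p. 45] -/
theorem Λ_pred_mul_le {lam lam' c : ℝ} (h : c * lam' ≤ lam) {r : ℕ} (hr2 : 2 ≤ r)
    (hrr : r ≤ 𝒮.r₀) (N : ℕ) : 𝒮.Λ lam' (r - 1) N * (c * 𝒮.ξ N * 𝒮.δ N) ≤ 𝒮.Λ lam r N := by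
  rw [𝒮.Λ_pred_mul_eq lam' c hr2 hrr N]
  exact 𝒮.Λ_mono h r N

/-- Second regime: under `(i)_N` (`size_N(𝔓) ≤ (B_r + D₀) τ δ^{r₀−r}`) and `c λ_{r−1} (B_r + D₀) ≤ 1`,
`Λ_{r−1} · c ξ δ size_N(𝔓) ≤ S(N)`. [cite: Philippon1986Criteres, §3 p. 45] -/
theorem Λ_pred_mul_size_le {lam' c s : ℝ} (hlam' : 0 ≤ lam') (hc : 0 ≤ c) {r : ℕ} (hr2 : 2 ≤ r)
    (hrr : r ≤ 𝒮.r₀) (N : ℕ) (h : c * lam' * (𝒮.B r + 𝒮.D₀) ≤ 1) (hs0 : 0 ≤ s)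
    (hs : s ≤ (𝒮.B r + 𝒮.D₀) * 𝒮.τ N * 𝒮.δ N ^ (𝒮.r₀ - r)) :
    𝒮.Λ lam' (r - 1) N * (c * 𝒮.ξ N * 𝒮.δ N * s) ≤ 𝒮.S N := by
  have heq : 𝒮.Λ lam' (r - 1) N * (c * 𝒮.ξ N * 𝒮.δ N * s) = 𝒮.Λ (c * lam') r N * s := by
    rw [← 𝒮.Λ_pred_mul_eq lam' c hr2 hrr N]; ring
  rw [heq]
  have hg := 𝒮.g_pos N
  have hδ := 𝒮.δ_pos N
  have hτ := 𝒮.τ_pos N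
  have hξ1 := 𝒮.one_le_ξ N
  have hδ1 := 𝒮.one_le_δ N
  have hBD : 0 ≤ 𝒮.B r + 𝒮.D₀ := add_nonneg (𝒮.B_nonneg r) (Nat.cast_nonneg _)
  -- drop the `ξ`-denominator
  have h1 : 𝒮.Λ (c * lam') r N ≤ c * lam' * 𝒮.g N * 𝒮.δ N ^ (r - 1) := by
    unfold Λ
    exact div_le_self (by positivity) (one_le_pow₀ hξ1)
  have h2 : 𝒮.δ N ^ (r - 1) * 𝒮.δ N ^ (𝒮.r₀ - r) ≤ 𝒮.δ N ^ 𝒮.k := by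
    rw [← pow_add]
    exact pow_le_pow_right₀ hδ1 (by have := 𝒮.r₀_le; omega)
  calc 𝒮.Λ (c * lam') r N * s ≤ (c * lam' * 𝒮.g N * 𝒮.δ N ^ (r - 1)) *
        ((𝒮.B r + 𝒮.D₀) * 𝒮.τ N * 𝒮.δ N ^ (𝒮.r₀ - r)) :=
        mul_le_mul h1 hs hs0 (by positivity)
    _ = (c * lam' * (𝒮.B r + 𝒮.D₀)) * (𝒮.g N * 𝒮.τ N * (𝒮.δ N ^ (r - 1) * 𝒮.δ N ^ (𝒮.r₀ - r))) := by
        ring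
    _ ≤ 1 * (𝒮.g N * 𝒮.τ N * 𝒮.δ N ^ 𝒮.k) := by
        apply mul_le_mul h (mul_le_mul_of_nonneg_left h2 (by positivity)) (by positivity) zero_le_one
    _ = 𝒮.S N := by rw [𝒮.S_eq N]; ring

/-- If the prime of `(A_r)` at level `N` has rank `r' < r`, it satisfies `(A_{r−1})` there (any
`0 ≤ λ_{r−1} ≤ λ_r`). [cite: Philippon1986Criteres, §3 p. 43 ("il n'y a rien à démontrer")] -/
theorem good_pred_of_rank_lt {lam lam' : ℝ} (h0 : 0 ≤ lam') (hle : lam' ≤ lam) {r : ℕ}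
    (hr2 : 2 ≤ r) (hrr : r ≤ 𝒮.r₀) {N : ℕ} {𝔓 : Ideal (Rx 𝒮.m)} (h𝔓 : 𝔓.IsPrime)
    (h𝔓hom : 𝔓.IsHomogeneous (homogeneousSubmodule (Fin (𝒮.m + 1)) ℚ)) (h0𝔓 : 𝒮.𝔓₀ ≤ 𝔓) {r' : ℕ}
    (hr'1 : 1 ≤ r') (hr'r : r' ≤ r - 1) (hunm : IsUnmixedOfRank 𝔓 r')
    (hdeg : (ideg 𝔓 r' : ℝ) ≤ 𝒮.D₀ * 𝒮.δ N ^ (𝒮.r₀ - r))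
    (hh : iheight 𝔓 r' ≤ 𝒮.B r * 𝒮.τ N * 𝒮.δ N ^ (𝒮.r₀ - r) / 𝒮.δ N)
    (hsmall : iabs 𝔓 r' 𝒮.ω ≤ exp (-(𝒮.Λ lam r N * 𝒮.size N 𝔓 r'))) :
    𝒮.Good lam' N (r - 1) 𝔓 := by
  have hδ := 𝒮.δ_pos N
  have hδ1 := 𝒮.one_le_δ N
  have hτ := 𝒮.τ_pos N
  have hpow : 𝒮.δ N ^ (𝒮.r₀ - r) ≤ 𝒮.δ N ^ (𝒮.r₀ - (r - 1)) := pow_le_pow_right₀ hδ1 (by omega)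
  have hB : 𝒮.B r ≤ 𝒮.B (r - 1) := by
    have := 𝒮.B_add_le r (by omega) hrr
    have : 0 ≤ (𝒮.D₀ : ℝ) * 𝒮.cB := mul_nonneg (Nat.cast_nonneg _) (le_trans zero_le_one 𝒮.one_le_cB)
    linarith
  refine ⟨h𝔓, h𝔓hom, h0𝔓, r', hr'1, hr'r, hunm, ?_, ?_, ?_⟩
  · exact hdeg.trans (mul_le_mul_of_nonneg_left hpow (Nat.cast_nonneg _))
  · refine hh.trans (div_le_div_of_nonneg_right ?_ hδ.le)
    exact mul_le_mul (mul_le_mul_of_nonneg_right hB hτ.le) hpow (by positivity)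
      (mul_nonneg (𝒮.B_nonneg _) hτ.le)
  · refine hsmall.trans (exp_le_exp.mpr (neg_le_neg ?_))
    exact mul_le_mul_of_nonneg_right (𝒮.Λ_pred_le h0 hle hr2 hrr N) (𝒮.size_nonneg N 𝔓 r')

/-- Degree bookkeeping of the step: `deg 𝔮 ≤ deg 𝔓 · dE ≤ D₀ δ^{r₀−r} δ = D₀ δ^{r₀−(r−1)}`.
[cite: Philippon1986Criteres, §3 p. 45] -/
theorem ideg_pred_le {r : ℕ} (hr2 : 2 ≤ r) (hrr : r ≤ 𝒮.r₀) {N M : ℕ} (hM0 : 𝒮.N₀ ≤ M)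
    (hMN : M ≤ N) (i : Fin (𝒮.M M)) {𝔓 𝔮 : Ideal (Rx 𝒮.m)}
    (hdeg : (ideg 𝔓 r : ℝ) ≤ 𝒮.D₀ * 𝒮.δ N ^ (𝒮.r₀ - r))
    (hqdeg : ideg 𝔮 (r - 1) ≤ ideg 𝔓 r * 𝒮.d M i) :
    (ideg 𝔮 (r - 1) : ℝ) ≤ 𝒮.D₀ * 𝒮.δ N ^ (𝒮.r₀ - (r - 1)) := by
  have hdE : (𝒮.d M i : ℝ) ≤ 𝒮.δ N := (𝒮.d_le M hM0 i).trans (𝒮.mono_δ hMN)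
  have e : 𝒮.r₀ - (r - 1) = (𝒮.r₀ - r) + 1 := by omega
  rw [e, pow_succ, ← mul_assoc]
  have h1 : (ideg 𝔮 (r - 1) : ℝ) ≤ ideg 𝔓 r * 𝒮.d M i := by exact_mod_cast hqdeg
  have hδ := 𝒮.δ_pos N
  exact h1.trans (mul_le_mul hdeg hdE (Nat.cast_nonneg _) (by positivity))

/-- Height bookkeeping of the step: from Prop. 4.11 2) + Prop. 4.7 2),
`h(𝔮) ≤ h(𝔓) dE + h(E) deg 𝔓 + (m(r+1) + m²) deg 𝔓 dE ≤ (B_r + D₀ c_B) τ δ^{r₀−r} ≤ B_{r−1} τ δ^{r₀−r}`.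
[cite: Philippon1986Criteres, §3 p. 45] -/
theorem iheight_pred_le {r : ℕ} (hr2 : 2 ≤ r) (hrr : r ≤ 𝒮.r₀) {N M : ℕ} (hM0 : 𝒮.N₀ ≤ M)
    (hMN : M ≤ N) (i : Fin (𝒮.M M)) {𝔓 𝔮 : Ideal (Rx 𝒮.m)}
    (hdeg : (ideg 𝔓 r : ℝ) ≤ 𝒮.D₀ * 𝒮.δ N ^ (𝒮.r₀ - r))
    (hh : iheight 𝔓 r ≤ 𝒮.B r * 𝒮.τ N * 𝒮.δ N ^ (𝒮.r₀ - r) / 𝒮.δ N)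
    (hqh : iheight 𝔮 (r - 1) ≤ iheight 𝔓 r * 𝒮.d M i + height (𝒮.E M i) * ideg 𝔓 r +
      ((𝒮.m : ℝ) * (r + 1) + (𝒮.m : ℝ) ^ 2) * ideg 𝔓 r * 𝒮.d M i) :
    iheight 𝔮 (r - 1) ≤ 𝒮.B (r - 1) * 𝒮.τ N * 𝒮.δ N ^ (𝒮.r₀ - (r - 1)) / 𝒮.δ N := by
  have hδ := 𝒮.δ_pos N
  have hτ := 𝒮.τ_pos N
  have hdE : (𝒮.d M i : ℝ) ≤ 𝒮.δ N := (𝒮.d_le M hM0 i).trans (𝒮.mono_δ hMN)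
  have hdE0 : (0 : ℝ) ≤ 𝒮.d M i := Nat.cast_nonneg _
  have hhE : height (𝒮.E M i) ≤ 𝒮.τ N :=
    ((𝒮.height_le M hM0 i).trans (𝒮.mono_σ hMN)).trans (𝒮.σ_le_τ N)
  have e : 𝒮.r₀ - (r - 1) = (𝒮.r₀ - r) + 1 := by omega
  have hgoal : 𝒮.B (r - 1) * 𝒮.τ N * 𝒮.δ N ^ (𝒮.r₀ - (r - 1)) / 𝒮.δ N =
      𝒮.B (r - 1) * 𝒮.τ N * 𝒮.δ N ^ (𝒮.r₀ - r) := by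
    rw [e, pow_succ]; field_simp
  rw [hgoal]
  have hP : 0 ≤ 𝒮.δ N ^ (𝒮.r₀ - r) := by positivity
  have hD : (0 : ℝ) ≤ 𝒮.D₀ := Nat.cast_nonneg _
  have hdeg0 : (0 : ℝ) ≤ ideg 𝔓 r := Nat.cast_nonneg _
  have hm0 : (0 : ℝ) ≤ 𝒮.m := Nat.cast_nonneg _
  have hB0 := 𝒮.B_nonneg r
  have hrk : (r : ℝ) + 1 ≤ 𝒮.k + 2 := by
    have := 𝒮.r₀_le
    have : (r : ℝ) ≤ 𝒮.k + 1 := by exact_mod_cast hrr.trans this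
    linarith
  have hmr : (𝒮.m : ℝ) * (r + 1) + (𝒮.m : ℝ) ^ 2 ≤ (𝒮.m : ℝ) * (𝒮.k + 2) + (𝒮.m : ℝ) ^ 2 := by
    nlinarith [mul_le_mul_of_nonneg_left hrk hm0]
  -- the three terms
  have t1 : iheight 𝔓 r * (𝒮.d M i : ℝ) ≤ 𝒮.B r * 𝒮.τ N * 𝒮.δ N ^ (𝒮.r₀ - r) := by
    have h1 : iheight 𝔓 r * (𝒮.d M i : ℝ) ≤
        (𝒮.B r * 𝒮.τ N * 𝒮.δ N ^ (𝒮.r₀ - r) / 𝒮.δ N) * 𝒮.δ N :=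
      mul_le_mul hh hdE hdE0 (by positivity)
    rwa [div_mul_cancel₀ _ hδ.ne'] at h1
  have t2 : height (𝒮.E M i) * (ideg 𝔓 r : ℝ) ≤ 𝒮.τ N * (𝒮.D₀ * 𝒮.δ N ^ (𝒮.r₀ - r)) :=
    mul_le_mul hhE hdeg hdeg0 hτ.le
  have t3a : ((𝒮.m : ℝ) * (r + 1) + (𝒮.m : ℝ) ^ 2) * ideg 𝔓 r ≤
      ((𝒮.m : ℝ) * (𝒮.k + 2) + (𝒮.m : ℝ) ^ 2) * (𝒮.D₀ * 𝒮.δ N ^ (𝒮.r₀ - r)) :=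
    mul_le_mul hmr hdeg hdeg0 (by positivity)
  have t3 : ((𝒮.m : ℝ) * (r + 1) + (𝒮.m : ℝ) ^ 2) * ideg 𝔓 r * 𝒮.d M i ≤
      ((𝒮.m : ℝ) * (𝒮.k + 2) + (𝒮.m : ℝ) ^ 2) * (𝒮.D₀ * 𝒮.δ N ^ (𝒮.r₀ - r)) * 𝒮.τ N :=
    mul_le_mul t3a (hdE.trans (𝒮.δ_le_τ N)) hdE0 (by positivity)
  have hB := 𝒮.B_add_le r (by omega) hrr
  have hcB : 𝒮.cB = 1 + (𝒮.m : ℝ) * (𝒮.k + 2) + (𝒮.m : ℝ) ^ 2 := rfl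
  have hτP : 0 ≤ 𝒮.τ N * 𝒮.δ N ^ (𝒮.r₀ - r) := by positivity
  calc iheight 𝔮 (r - 1)
      ≤ iheight 𝔓 r * 𝒮.d M i + height (𝒮.E M i) * ideg 𝔓 r +
          ((𝒮.m : ℝ) * (r + 1) + (𝒮.m : ℝ) ^ 2) * ideg 𝔓 r * 𝒮.d M i := hqh
    _ ≤ 𝒮.B r * 𝒮.τ N * 𝒮.δ N ^ (𝒮.r₀ - r) + 𝒮.τ N * (𝒮.D₀ * 𝒮.δ N ^ (𝒮.r₀ - r)) +
          ((𝒮.m : ℝ) * (𝒮.k + 2) + (𝒮.m : ℝ) ^ 2) * (𝒮.D₀ * 𝒮.δ N ^ (𝒮.r₀ - r)) * 𝒮.τ N := by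
        linarith
    _ = (𝒮.B r + 𝒮.D₀ * 𝒮.cB) * (𝒮.τ N * 𝒮.δ N ^ (𝒮.r₀ - r)) := by rw [hcB]; ring
    _ ≤ 𝒮.B (r - 1) * (𝒮.τ N * 𝒮.δ N ^ (𝒮.r₀ - r)) := mul_le_mul_of_nonneg_right hB hτP
    _ = 𝒮.B (r - 1) * 𝒮.τ N * 𝒮.δ N ^ (𝒮.r₀ - r) := by ring

/-- The bound `T` of the weighted pigeonhole: `δ (h(J) + m² deg J) + τ deg J ≤ (1 + m²) size_N(J)`.
[folklore] -/
theorem pigeonhole_bound_le (N : ℕ) (J : Ideal (Rx 𝒮.m)) (r' : ℕ) {Z : ℝ} (hJ : 𝒮.size N J r' ≤ Z) :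
    𝒮.δ N * (iheight J r' + (𝒮.m : ℝ) ^ 2 * ideg J r') + 𝒮.τ N * ideg J r' ≤
      (1 + (𝒮.m : ℝ) ^ 2) * Z := by
  have hδ := 𝒮.δ_pos N
  have hsz : 𝒮.size N J r' = 𝒮.δ N * iheight J r' + 𝒮.τ N * ideg J r' := rfl
  rw [hsz] at hJ
  have hh0 : 0 ≤ 𝒮.δ N * iheight J r' := mul_nonneg hδ.le (height_nonneg _)
  have hdeg0 : (0 : ℝ) ≤ ideg J r' := Nat.cast_nonneg _
  have h1 : 𝒮.δ N * ideg J r' ≤ 𝒮.τ N * ideg J r' := mul_le_mul_of_nonneg_right (𝒮.δ_le_τ N) hdeg0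
  have h2 : (𝒮.m : ℝ) ^ 2 * (𝒮.δ N * ideg J r') ≤ (𝒮.m : ℝ) ^ 2 * Z :=
    mul_le_mul_of_nonneg_left (by linarith) (sq_nonneg _)
  nlinarith

/-- The quality of the component: if `Λ' · 4T ≤ u`, `m³ deg J ≤ u/4` and
`|𝔮| ≤ exp(−((u/2 − m³ deg J)/T) size_N(𝔮))`, then `|𝔮| ≤ exp(−Λ' size_N(𝔮))`. [folklore] -/
theorem iabs_pred_le (N r' : ℕ) (𝔮 : Ideal (Rx 𝒮.m)) {Λ' u T D : ℝ} (hT : 0 < T) (hD : D ≤ u / 4)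
    (h4T : Λ' * (4 * T) ≤ u)
    (hq : iabs 𝔮 r' 𝒮.ω ≤ exp (-((u / 2 - D) / T) * (𝒮.δ N * iheight 𝔮 r' + 𝒮.τ N * ideg 𝔮 r'))) :
    iabs 𝔮 r' 𝒮.ω ≤ exp (-(Λ' * 𝒮.size N 𝔮 r')) := by
  refine hq.trans (exp_le_exp.mpr ?_)
  rw [neg_mul, neg_le_neg_iff]
  have hsz : 𝒮.size N 𝔮 r' = 𝒮.δ N * iheight 𝔮 r' + 𝒮.τ N * ideg 𝔮 r' := rfl
  rw [← hsz]
  apply mul_le_mul_of_nonneg_right _ (𝒮.size_nonneg N _ _)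
  rw [le_div_iff₀ hT]
  by_cases hlam : 0 ≤ Λ'
  · nlinarith
  · have hlam' := not_le.mp hlam
    have : Λ' * T ≤ 0 := by nlinarith
    nlinarith

/-! ### The component of the cut -/

/-- **The component** (Philippon 1986, pp. 44–45; Prop. 4.7 + weighted pigeonhole
`exists_component_le_exp`): for `𝔓 ⊇ 𝔓₀` prime of rank exactly `r` (`2 ≤ r ≤ min(r₀, m)`) with
`(i)_N`, a generator `E = E M i ∉ 𝔓` (`N₀ ≤ M ≤ N`), and `J` homogeneous unmixed of rank `r − 1` with
`V(J) = V((𝔓, E))`, `|J(ω̄)| ≤ e^{−u/2}`, `size_N(J) ≤ 5ξδ(2+m(k+3)) size_N(𝔓)`, `m³ deg J ≤ u/4` and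
`Λ_{λ'}(r−1, N) · 20(1+m²)(2+m(k+3)) ξ δ size_N(𝔓) ≤ u`, some prime `𝔮 ⊇ 𝔓`, `𝔮 ∋ E`, satisfies
`(A_{r−1})` at level `N` with quality `λ'`. [cite: Philippon1986Criteres, §3 Lemme 2.14 (pp. 44–45)]
[cite: NesterenkoPhilippon2001, Ch. 3 Prop. 4.7, Prop. 4.11 1)–2), Prop. 4.13 (pp. 39–41)] -/
theorem good_component (h44 : NesterenkoPhilippon2001_ch3_prop_4_4)
    (h47 : NesterenkoPhilippon2001_ch3_prop_4_7) (h411 : NesterenkoPhilippon2001_ch3_prop_4_11)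
    (h413 : NesterenkoPhilippon2001_ch3_prop_4_13)
    {lam' : ℝ} {r : ℕ} (hr2 : 2 ≤ r) (hrr : r ≤ 𝒮.r₀) (hrm : r ≤ 𝒮.m) {N M : ℕ} (hM0 : 𝒮.N₀ ≤ M)
    (hMN : M ≤ N) {𝔓 : Ideal (Rx 𝒮.m)} (h𝔓 : 𝔓.IsPrime)
    (h𝔓hom : 𝔓.IsHomogeneous (homogeneousSubmodule (Fin (𝒮.m + 1)) ℚ)) (h0𝔓 : 𝒮.𝔓₀ ≤ 𝔓)
    (h𝔓unm : IsUnmixedOfRank 𝔓 r) (hdeg : (ideg 𝔓 r : ℝ) ≤ 𝒮.D₀ * 𝒮.δ N ^ (𝒮.r₀ - r))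
    (hh : iheight 𝔓 r ≤ 𝒮.B r * 𝒮.τ N * 𝒮.δ N ^ (𝒮.r₀ - r) / 𝒮.δ N) (i : Fin (𝒮.M M))
    (hi : 𝒮.E M i ∉ 𝔓) {J : Ideal (Rx 𝒮.m)}
    (hJhom : J.IsHomogeneous (homogeneousSubmodule (Fin (𝒮.m + 1)) ℚ))
    (hJunm : IsUnmixedOfRank J (r - 1)) (hJV : projZeros J = projZeros (𝔓 ⊔ Ideal.span {𝒮.E M i}))
    {u : ℝ} (hu : 0 ≤ u) (hJsmall : iabs J (r - 1) 𝒮.ω ≤ exp (-(u / 2)))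
    (hJsize : 𝒮.size N J (r - 1) ≤ 5 * 𝒮.ξ N * 𝒮.δ N * (2 + 𝒮.m * (𝒮.k + 3)) * 𝒮.size N 𝔓 r)
    (hJdeg : (𝒮.m : ℝ) ^ 3 * ideg J (r - 1) ≤ u / 4)
    (hΛ' : 𝒮.Λ lam' (r - 1) N *
      (20 * ((1 + (𝒮.m : ℝ) ^ 2) * (2 + 𝒮.m * (𝒮.k + 3))) * 𝒮.ξ N * 𝒮.δ N * 𝒮.size N 𝔓 r) ≤ u) :
    ∃ 𝔮 : Ideal (Rx 𝒮.m), 𝔓 ≤ 𝔮 ∧ 𝒮.E M i ∈ 𝔮 ∧ 𝒮.Good lam' N (r - 1) 𝔮 := by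
  classical
  have hr1 : 1 ≤ r - 1 := by omega
  have hrm' : r - 1 ≤ 𝒮.m := by omega
  have hδ := 𝒮.δ_pos N
  have hξ := 𝒮.ξ_pos N
  have hdeg1 : 1 ≤ ideg 𝔓 r :=
    Literature.Barriers.Schanuel.one_le_ideg_of_isPrime h44 (by omega) hrm h𝔓 h𝔓hom h𝔓unm
  have hs1 : 1 ≤ 𝒮.size N 𝔓 r := by
    have h1 : (1 : ℝ) ≤ 𝒮.τ N * ideg 𝔓 r :=
      one_le_mul_of_one_le_of_one_le (𝒮.one_le_τ N) (by exact_mod_cast hdeg1)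
    exact h1.trans (𝒮.τ_mul_ideg_le_size N 𝔓 r)
  have hT : 0 < (1 + (𝒮.m : ℝ) ^ 2) *
      (5 * 𝒮.ξ N * 𝒮.δ N * (2 + 𝒮.m * (𝒮.k + 3)) * 𝒮.size N 𝔓 r) := by positivity
  -- minimal primary decomposition of `J`; weighted pigeonhole with `a = δ`, `b = τ`, `U = u/2`
  obtain ⟨t, ht⟩ : ∃ t : Finset (Ideal (Rx 𝒮.m)), Submodule.IsMinimalPrimaryDecomposition J t :=
    Submodule.IsLasker.exists_isMinimalPrimaryDecomposition (Submodule.isLasker _ _) J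
  have hTle := 𝒮.pigeonhole_bound_le N J (r - 1) hJsize
  have hU : (𝒮.m : ℝ) ^ 3 * ideg J (r - 1) ≤ u / 2 := by linarith
  obtain ⟨Q, hQ, hQsmall⟩ := exists_component_le_exp h47 hr1 hrm' hJhom hJunm ht 𝒮.ω_ne_zero
    hδ.le hT hTle hU hJsmall
  -- the component `𝔮 = √Q`
  obtain ⟨hqprime, hqhom, hqunm, -, -⟩ :=
    Literature.Barriers.Schanuel.radical_component_facts hJhom hJunm ht hQ
  have hne : (projZeros Q.radical).Nonempty := by
    obtain ⟨β, hβ, -⟩ := h413 𝒮.m (r - 1) Q.radical hr1 hrm' hqhom hqunm 𝒮.ω 𝒮.ω_ne_zero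
    exact ⟨β, hβ⟩
  obtain ⟨h𝔓le, hEmem, hqdeg, hqh⟩ := cut_component_facts h47 h411 hr2 hrm h𝔓 h𝔓hom h𝔓unm
    (𝒮.isHomogeneous_E M i) hi hJhom hJunm hJV ht hQ hne
  refine ⟨Q.radical, h𝔓le, hEmem, hqprime, hqhom, h0𝔓.trans h𝔓le, r - 1, hr1, le_rfl, hqunm,
    𝒮.ideg_pred_le hr2 hrr hM0 hMN i hdeg hqdeg, 𝒮.iheight_pred_le hr2 hrr hM0 hMN i hdeg hh hqh,
    𝒮.iabs_pred_le N (r - 1) Q.radical hT hJdeg ?_ hQsmall⟩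
  -- `Λ' · 4T ≤ u`
  refine le_trans (le_of_eq ?_) hΛ'
  ring

/-! ### The induction step -/

/-- **Lemme 2.14** (Philippon 1986, §3, pp. 43–45: "si `n + 1 ≥ r > 1`, alors `(A_r)` entraîne
`(A_{r−1})`"), at a fixed level `N ≥ N₀`, `2 ≤ r ≤ min(r₀, m)`: if `𝔓` satisfies `(A_r)` at level `N`
with quality `λ`, some prime `𝔮` satisfies `(A_{r−1})` at level `N` with quality `λ'`, provided
`c λ' ≤ λ`, `c λ' (B_r + D₀) ≤ 1` (`c = 20(1+m²)(2+m(k+3))`) and `Λ_r(N)`, `C`, `N` are large as stated.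
[cite: Philippon1986Criteres, §3 Lemme 2.14 (pp. 43–45)]
[cite: NesterenkoPhilippon2001, Ch. 3 Prop. 4.7, 4.11, Cor. 4.12, Prop. 4.13 (pp. 39–41)] -/
theorem step (h44 : NesterenkoPhilippon2001_ch3_prop_4_4) (h47 : NesterenkoPhilippon2001_ch3_prop_4_7)
    (h411 : NesterenkoPhilippon2001_ch3_prop_4_11) (h412 : NesterenkoPhilippon2001_ch3_cor_4_12)
    (h413 : NesterenkoPhilippon2001_ch3_prop_4_13) {lam lam' : ℝ} {r : ℕ} (hr2 : 2 ≤ r)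
    (hrr : r ≤ 𝒮.r₀) (hrm : r ≤ 𝒮.m) {N : ℕ} (hN : 𝒮.N₀ ≤ N) {𝔓 : Ideal (Rx 𝒮.m)}
    (hgood : 𝒮.Good lam N r 𝔓) (hlam'0 : 0 ≤ lam')
    (hlam'a : 20 * ((1 + (𝒮.m : ℝ) ^ 2) * (2 + 𝒮.m * (𝒮.k + 3))) * lam' ≤ lam)
    (hlam'b : 20 * ((1 + (𝒮.m : ℝ) ^ 2) * (2 + 𝒮.m * (𝒮.k + 3))) * lam' * (𝒮.B r + 𝒮.D₀) ≤ 1)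
    (hΛa : 2 + 8 * r * (𝒮.m : ℝ) ^ 3 ≤ 𝒮.Λ lam r N)
    (hΛb : 2 * (1 + 11 * (𝒮.m : ℝ) ^ 2) ≤ 𝒮.Λ lam r N)
    (hΛc : 10 * (1 + 12 * (𝒮.m : ℝ) ^ 2) * 𝒮.ξ N ≤ 𝒮.Λ lam r N)
    (hΛd : 20 * (𝒮.m : ℝ) ^ 3 * 𝒮.ξ N ≤ 𝒮.Λ lam r N)
    (hCa : 2 * (1 + 11 * (𝒮.m : ℝ) ^ 2) * (𝒮.B r + 𝒮.D₀) ≤ 𝒮.C) (hCb : 2 * (𝒮.m : ℝ) ≤ 𝒮.C)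
    (hCc : log (4 * 𝒮.Θ ^ 2) ≤ 𝒮.C) (hCd : 20 * (𝒮.m : ℝ) ^ 3 * 𝒮.D₀ ≤ 𝒮.C)
    (hNbig : 𝒮.R 𝒮.N₀ + log (1 / 𝒮.κ) < 𝒮.Λ lam r N * 𝒮.τ N / (2 * r)) :
    ∃ 𝔮 : Ideal (Rx 𝒮.m), 𝒮.Good lam' N (r - 1) 𝔮 := by
  set c : ℝ := 20 * ((1 + (𝒮.m : ℝ) ^ 2) * (2 + 𝒮.m * (𝒮.k + 3))) with hcdef
  have hm0 : (0 : ℝ) ≤ 𝒮.m := Nat.cast_nonneg _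
  have hc1 : 1 ≤ c := by
    rw [hcdef]
    have h1 : (1 : ℝ) ≤ 1 + (𝒮.m : ℝ) ^ 2 := by nlinarith [sq_nonneg (𝒮.m : ℝ)]
    have h2 : (1 : ℝ) ≤ 2 + 𝒮.m * (𝒮.k + 3) := by nlinarith [mul_nonneg hm0 (by positivity : (0 : ℝ) ≤ 𝒮.k + 3)]
    nlinarith [one_le_mul_of_one_le_of_one_le h1 h2]
  have hle : lam' ≤ lam := le_trans (le_mul_of_one_le_left hlam'0 hc1) hlam'a
  have hlam0 : 0 ≤ lam := hlam'0.trans hle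
  obtain ⟨h𝔓, h𝔓hom, h0𝔓, r', hr'1, hr'r, hunm, hdeg, hh, hsmall⟩ := hgood
  rcases hr'r.eq_or_lt with h | h
  · -- rank exactly `r`: cut and take a component
    subst h
    obtain ⟨M, i, J, hM0, hMN, hi, hJhom, hJunm, hJV, hJsmall, hJsize, hJdeg⟩ :=
      𝒮.exists_cut h44 h411 h412 h413 hr2 hrr hrm hN h𝔓 h𝔓hom hunm hdeg hh hsmall hΛa hΛb hΛc hΛd
        hCa hCb hCc hCd hNbig
    have hs0 : 0 ≤ 𝒮.size N 𝔓 r' := 𝒮.size_nonneg N 𝔓 r'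
    have hu : 0 ≤ min (𝒮.Λ lam r' N * 𝒮.size N 𝔓 r') (𝒮.S N) :=
      le_min (mul_nonneg (𝒮.Λ_nonneg hlam0 r' N) hs0) (𝒮.S_pos N).le
    have hΛ' : 𝒮.Λ lam' (r' - 1) N * (c * 𝒮.ξ N * 𝒮.δ N * 𝒮.size N 𝔓 r') ≤
        min (𝒮.Λ lam r' N * 𝒮.size N 𝔓 r') (𝒮.S N) := by
      refine le_min ?_ ?_
      · have h1 := 𝒮.Λ_pred_mul_le hlam'a hr2 hrr N
        have h2 := mul_le_mul_of_nonneg_right h1 hs0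
        calc 𝒮.Λ lam' (r' - 1) N * (c * 𝒮.ξ N * 𝒮.δ N * 𝒮.size N 𝔓 r')
            = 𝒮.Λ lam' (r' - 1) N * (c * 𝒮.ξ N * 𝒮.δ N) * 𝒮.size N 𝔓 r' := by ring
          _ ≤ 𝒮.Λ lam r' N * 𝒮.size N 𝔓 r' := h2
      · exact 𝒮.Λ_pred_mul_size_le hlam'0 (by linarith) hr2 hrr N hlam'b hs0
          (𝒮.size_le_of_bounds N hdeg hh)
    obtain ⟨𝔮, -, -, hgood'⟩ := 𝒮.good_component h44 h47 h411 h413 hr2 hrr hrm hM0 hMN h𝔓 h𝔓hom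
      h0𝔓 hunm hdeg hh i hi hJhom hJunm hJV hu hJsmall hJsize hJdeg hΛ'
    exact ⟨𝔮, hgood'⟩
  · -- rank `< r`: nothing to do
    exact ⟨𝔓, 𝒮.good_pred_of_rank_lt hlam'0 hle hr2 hrr h𝔓 h𝔓hom h0𝔓 hr'1 (by omega) hunm hdeg hh
      hsmall⟩

end Setup

end PhilipponMain

end Literature.NumberTheory.Transcendental

end
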